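import Summits.QuantumFields.BalabanUV.Beta.GAN24.HalfMemberSlavedDivergenceLetters
import Summits.QuantumFields.BalabanUV.Beta.GAN24.RelSourceHalf

/-!
# `BalabanUV.Beta.GAN24.HalfMemberSlavedDivergenceDrift` — binder row G-an2-4 ∕ (CONV-C), W-slot EXIT (α), PART 6 of `HalfMemberSlavedDivergence` ((α-END-b1)′, the DRIFT
# twin): **THE TWO SLOT-DIVERGENCE LETTER ROWS OF THE `ε`-MEMBER's ONE-STEP DIFFERENCE `y_{l+2} − y_{l+1}`** — the (b1)-side input of leaf-03 g66's FILE 5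
# `HalfMemberCellDriftOfDivergences` («the four rows on `Z_{l+1} − Z_l`») for the OWNER gan24-p1 g34's displayed drift row `hcelld` of `T2DriftEvenEndRows` — FROM p2's
# (F4b) one-step drift row of the dressed source and the DIFFERENCES of the slaved `e3OfK` summands at two consecutive levels (displayed; the drift twin of p2 g45's
# `BlockCommutatorStepLetter` rows, to be supplied from the S-slot ∕ K-slot Cauchy rows `hSall ∕ hKall`)
# (G-an2-4 FORMAL swarm → CRUX TEAM (2), leaf-01 lineage `b2b-balaban-gan24-formalise-leaf-01`, gen 72)

NOT IN PRINT; OUR BOOKKEEPING ([folklore] composition BY NAME; 0 `def`, 0 cited facts, 0 `def … : Prop`, 0 sorry).  HONEST FRAMING (cell contract, verbatim):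
«discharging `BetaPertH` makes Bałaban's UV stability UNCONDITIONAL — a real constructive-QFT result; it is NOT the continuum limit and NOT the Clay problem.»
HONEST DEPENDENCY (verbatim): «continuum YM on T⁴ ⇐ BetaPertH ∧ nine spine estimates (0/9 proved); BetaPertH ⇐ (D1) ∧ (D4) ∧ CAP+tail; G-an2-4 gates asym, D1
and NE2/3/4.»

WHAT (levels `l → l+1` and `l+1 → l+2`; every `ε` with `|ε| ≤ 1`, rate `0 ≤ δ`; letters at the two levels `S₀ R₀ R₀″ cH₀` (laws of `T̃_l`) and `S₁ R₁ R₁″ cH₁` (laws of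
`T̃_{l+1}`), shared generator `X`, parities `hC₀ hR₀ hR₀″ hC₁ hR₁ hR₁″`; in-block root, `1 ≤ Lc`, border data; generic `d`):
* §0 `divV_fst_sub` (the first-slot divergence is linear over differences; the second slot's twin is in PART 6b), `half_sub` (the `ε`-halves of two tables differ by the `ε`-half of their difference —
  MY `RelSourceHalf.parity_sub`).
* §1 **`slotLetters_halfMember_succ_sub_of_rows`** — HYPOTHESES: (i′) p2's (F4b) one-step drift row of the dressed source `hbF4d : LocStencil₂ (b̃_{l+1} − b̃_l) Cbd δ`;
  (ii′) TWO DISPLAYED rows on the DIFFERENCE of the slaved summand tables `E_{l+1}(p) − E_l(p)` (passive reading `hEd₁`, active reading `hEd₂`; `E_m(p)` as in PART 4 with the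
  level-`m` letters); CONCLUSION: leaf-03's `h₁ ∧ h₂` rows for `Y := y_{l+2} − y_{l+1}` (Pi-difference of the END-spelled members) with constants `(d+1)(e^{3δ}+1)·Cbd + CEd₁`
  and `(d+1)(e^{δ}+1)·Cbd + CEd₂` — PART 2's slaved identities at BOTH levels, §0, the OWNER's `locStencil₂_halfTable`, leaf-02's letters, `locStencil₂_add`; the consumer puts
  `Cbd := Cbd′·θ^l`, `CEd := CEd′·θ^l`.
Asserts NOTHING about Bałaban's tables; 0 estimate; rows (i′)(ii′), the table laws and parities are HYPOTHESES; NOTHING of `hcell` ∕ `hcelld` ∕ (Q-L) ∕ (C) ∕ «T2Shape» ∕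
«T2Drift» ∕ (hW, hWall) discharged; (β) untouched; NEVER «G-an2-4 closed» as (CONV-C); NOT D1, NOT `BetaPertH`, NOT continuum, NOT Clay.  2026-08-23.
-/

noncomputable section

open Finset
open scoped BigOperators
open Literature.MathematicalPhysics.QuantumFieldTheory
open Literature.MathematicalPhysics.QuantumFieldTheory.Balaban1983to89
open Literature.MathematicalPhysics.QuantumFieldTheory.Balaban1983to89.Beta
open ExpKernelCalculus (MKer Decays comp)
open OneStepResolventKernel (Fib)
open OneStepKernelFamily (KInvStep)
open SecondOrderResponse (W2SymOfK)
open BalabanStepJetsSucc (mmRead)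
open BalabanStepW2 (K3OfK M2Of)
open KernelWard (divV divW)
open AffineAveraging (box toSite unitVec)
open BalabanCompositeJets (LocStencil₂)
open AveragingMixedJetTables (mixFFAt)
open Summit.QuantumFields.BalabanUV.Beta.TameKernelCalculus (trK)
open Summit.QuantumFields.BalabanUV.Beta.BorderedHessian (sgnK)
open Summit.QuantumFields.BalabanUV.Beta.HessKerDressedUnits (unitK unitS)
open Summit.QuantumFields.BalabanUV.Beta.SecondOrderUnits (unitM unitS₂ unitM₂)
open Summit.QuantumFields.BalabanUV.Beta.AxialDressingRooted (coDressKBmAt)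
open Summit.QuantumFields.BalabanUV.Beta.SpineRooted (T2RecAt SpureRecAt M1At e3OfK)
open Summit.QuantumFields.BalabanUV.Beta.GAN24.CombesThomas (sfStep smStep)
open Summit.QuantumFields.BalabanUV.Beta.GAN24.BiStencilZeroMode (Tab)
open Summit.QuantumFields.BalabanUV.Beta.GAN24.WSlotT2OfPieces (locStencil₂_add)
open Summit.QuantumFields.BalabanUV.Beta.GAN24.SlotDivergenceLetters (letter_fst_of_locStencil₂ letter_snd_of_locStencil₂)
open Summit.QuantumFields.BalabanUV.Beta.GAN24.T2ShapeEvenEnd (locStencil₂_halfTable)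
open Summit.QuantumFields.BalabanUV.Beta.GAN24.RelSourceHalf (parity_sub)
open Summit.QuantumFields.BalabanUV.Beta.GAN24.HalfMemberSlavedDivergenceComb (divW_halfMember_succ_eq_slaved divV_snd_halfMember_succ_eq_slaved)

namespace Summit.QuantumFields.BalabanUV.Beta.GAN24.HalfMemberSlavedDivergenceDrift

variable {d : ℕ} {Lc : ℕ} [NeZero Lc] {r : Fin (d + 1) → ℕ}

/-! ## §0 Linearity over differences -/

/-- [folklore] The first-slot divergence is linear over differences of tables. -/
theorem divV_fst_sub (A B : Tab d) (p : Fin (d + 1) → ℤ) (κ' : Fin (d + 1)) (u' : Fin (d + 1) → ℤ) :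
    divV (fun κ₁ u₁ => (A - B) κ₁ u₁ κ' u') p = divV (fun κ₁ u₁ => A κ₁ u₁ κ' u') p - divV (fun κ₁ u₁ => B κ₁ u₁ κ' u') p := by
  simp only [KernelWard.divV, Pi.sub_apply, ← Finset.sum_sub_distrib]
  exact Finset.sum_congr rfl fun μ _ => by abel

/-- [folklore] **THE `ε`-HALVES OF TWO TABLES DIFFER BY THE `ε`-HALF OF THEIR DIFFERENCE** (`parity_sub` + linearity). -/
theorem half_sub (A B : Tab d) (ε : ℝ) :
    ((1 / 2 : ℝ) • (A + ε • fun κ u κ' u' => sgnK (trK (A κ u κ' u')))) - ((1 / 2 : ℝ) • (B + ε • fun κ u κ' u' => sgnK (trK (B κ u κ' u'))))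
      = (1 / 2 : ℝ) • ((A - B) + ε • fun κ u κ' u' => sgnK (trK ((A - B) κ u κ' u'))) := by
  rw [parity_sub]
  simp only [smul_add, smul_sub]
  abel

/-! ## §1 The slot letters of the one-step difference -/

/-- NOT IN PRINT; OUR BOOKKEEPING.  **THE SLOT LETTERS OF THE `ε`-MEMBER's ONE-STEP DIFFERENCE** (leaf-03 g66's `h₁ ∕ h₂` spellings for `Y := y_{l+2} − y_{l+1}`): from the
dressed source's one-step drift row (halved: the OWNER's `locStencil₂_halfTable` ⨾ §0 `half_sub`; leaf-02's ι-WIN letters) and the two displayed rows on the difference of the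
slaved summand tables at levels `l+1` and `l` (PART 2 §3 ∕ §3b at both levels; §0 linearity; `locStencil₂_add`). -/
theorem slotLetters_halfMember_succ_sub_of_rows (hLc : 1 ≤ Lc) (hr : r ∈ box (d + 1) Lc) (cE cVH cΛ cE₂ cB : ℝ) (Tc : Fin 4 → Fin 4 → Fin 4 → Fin 4 → ℝ)
    {vh₂S : Tab d} (hBff : ∀ κ u κ' u' x z (α β : Fin (d + 1)), vh₂S κ u κ' u' x z (Sum.inl α) (Sum.inl β) = 0)
    (hBmm : ∀ κ u κ' u' x z (μ ν : Fin (d + 1)), vh₂S κ u κ' u' x z (Sum.inr μ) (Sum.inr ν) = 0)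
    (hB : ∃ C δ : ℝ, 0 < δ ∧ LocStencil₂ vh₂S C δ) (l : ℕ)
    {X : (Fin (d + 1) → ℤ) → MKer (d + 1) (Fib d)}
    {S₀ : Fin (d + 1) → (Fin (d + 1) → ℤ) → MKer (d + 1) (Fib d)}
    {R₀ R₀'' : (Fin (d + 1) → ℤ) → Fin (d + 1) → (Fin (d + 1) → ℤ) → MKer (d + 1) (Fib d)} {cH₀ : ℝ} (hcH₀ : cH₀ ≠ 0)
    (hTL₀ : ∀ (Y : Fin (d + 1) → ℤ) (κ' : Fin (d + 1)) (u' : Fin (d + 1) → ℤ),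
      cH₀ • ∑ v ∈ box (d + 1) Lc, divV (fun κ u => T2RecAt d Lc (toSite r) cE cVH cΛ cE₂ cB Tc vh₂S (mixFFAt (toSite r) Lc) l κ u κ' u') ((Lc : ℤ) • Y + toSite v)
        = comp (S₀ κ' u') (X Y) - comp (X Y) (S₀ κ' u') + R₀ Y κ' u')
    (hTL₀'' : ∀ (Y : Fin (d + 1) → ℤ) (κ : Fin (d + 1)) (u : Fin (d + 1) → ℤ),
      cH₀ • ∑ v ∈ box (d + 1) Lc, divV (T2RecAt d Lc (toSite r) cE cVH cΛ cE₂ cB Tc vh₂S (mixFFAt (toSite r) Lc) l κ u) ((Lc : ℤ) • Y + toSite v)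
        = comp (S₀ κ u) (X Y) - comp (X Y) (S₀ κ u) + R₀'' Y κ u)
    (hC₀ : ∀ (Y : Fin (d + 1) → ℤ) (κ : Fin (d + 1)) (u : Fin (d + 1) → ℤ),
      trK (comp (S₀ κ u) (X Y) - comp (X Y) (S₀ κ u)) = sgnK (comp (S₀ κ u) (X Y) - comp (X Y) (S₀ κ u)))
    (hR₀ : ∀ (Y : Fin (d + 1) → ℤ) (κ : Fin (d + 1)) (u : Fin (d + 1) → ℤ), trK (R₀ Y κ u) = -sgnK (R₀ Y κ u))
    (hR₀'' : ∀ (Y : Fin (d + 1) → ℤ) (κ : Fin (d + 1)) (u : Fin (d + 1) → ℤ), trK (R₀'' Y κ u) = -sgnK (R₀'' Y κ u))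
    {S₁ : Fin (d + 1) → (Fin (d + 1) → ℤ) → MKer (d + 1) (Fib d)}
    {R₁ R₁'' : (Fin (d + 1) → ℤ) → Fin (d + 1) → (Fin (d + 1) → ℤ) → MKer (d + 1) (Fib d)} {cH₁ : ℝ} (hcH₁ : cH₁ ≠ 0)
    (hTL₁ : ∀ (Y : Fin (d + 1) → ℤ) (κ' : Fin (d + 1)) (u' : Fin (d + 1) → ℤ),
      cH₁ • ∑ v ∈ box (d + 1) Lc, divV (fun κ u => T2RecAt d Lc (toSite r) cE cVH cΛ cE₂ cB Tc vh₂S (mixFFAt (toSite r) Lc) (l + 1) κ u κ' u') ((Lc : ℤ) • Y + toSite v)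
        = comp (S₁ κ' u') (X Y) - comp (X Y) (S₁ κ' u') + R₁ Y κ' u')
    (hTL₁'' : ∀ (Y : Fin (d + 1) → ℤ) (κ : Fin (d + 1)) (u : Fin (d + 1) → ℤ),
      cH₁ • ∑ v ∈ box (d + 1) Lc, divV (T2RecAt d Lc (toSite r) cE cVH cΛ cE₂ cB Tc vh₂S (mixFFAt (toSite r) Lc) (l + 1) κ u) ((Lc : ℤ) • Y + toSite v)
        = comp (S₁ κ u) (X Y) - comp (X Y) (S₁ κ u) + R₁'' Y κ u)
    (hC₁ : ∀ (Y : Fin (d + 1) → ℤ) (κ : Fin (d + 1)) (u : Fin (d + 1) → ℤ),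
      trK (comp (S₁ κ u) (X Y) - comp (X Y) (S₁ κ u)) = sgnK (comp (S₁ κ u) (X Y) - comp (X Y) (S₁ κ u)))
    (hR₁ : ∀ (Y : Fin (d + 1) → ℤ) (κ : Fin (d + 1)) (u : Fin (d + 1) → ℤ), trK (R₁ Y κ u) = -sgnK (R₁ Y κ u))
    (hR₁'' : ∀ (Y : Fin (d + 1) → ℤ) (κ : Fin (d + 1)) (u : Fin (d + 1) → ℤ), trK (R₁'' Y κ u) = -sgnK (R₁'' Y κ u))
    (ε : ℝ) (hε : |ε| ≤ 1) {Cbd CEd₁ δ : ℝ} (hδ : 0 ≤ δ)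
    (hbF4d : LocStencil₂ ((fun κ u κ' u' => (cE₂ * (Lc : ℝ) ^ (2 * (d + 1))) • mmRead Lc (K3OfK
            (unitK (sfStep Lc (l + 1)) (smStep d Lc (l + 1)) (coDressKBmAt (toSite r) Lc (KInvStep (d := d) Lc (l + 1)))) Lc
            (unitS (sfStep Lc (l + 1)) (smStep d Lc (l + 1)) (SpureRecAt d Lc (toSite r) cE cVH cΛ (l + 1))) (unitM (sfStep Lc (l + 1)) (smStep d Lc (l + 1)) (M1At d Lc (toSite r) cΛ (l + 1)))
            (W2SymOfK (unitK (sfStep Lc (l + 1)) (smStep d Lc (l + 1)) (coDressKBmAt (toSite r) Lc (KInvStep (d := d) Lc (l + 1)))) Lc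
              (unitS (sfStep Lc (l + 1)) (smStep d Lc (l + 1)) (SpureRecAt d Lc (toSite r) cE cVH cΛ (l + 1))) (unitM (sfStep Lc (l + 1)) (smStep d Lc (l + 1)) (M1At d Lc (toSite r) cΛ (l + 1))) 0
              (unitM₂ (sfStep Lc (l + 1)) (smStep d Lc (l + 1)) (M2Of d Lc (mixFFAt (toSite r) Lc) (l + 1)))) κ u κ' u') + cB • vh₂S κ u κ' u')
      - (fun κ u κ' u' => (cE₂ * (Lc : ℝ) ^ (2 * (d + 1))) • mmRead Lc (K3OfK
            (unitK (sfStep Lc l) (smStep d Lc l) (coDressKBmAt (toSite r) Lc (KInvStep (d := d) Lc l))) Lc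
            (unitS (sfStep Lc l) (smStep d Lc l) (SpureRecAt d Lc (toSite r) cE cVH cΛ l)) (unitM (sfStep Lc l) (smStep d Lc l) (M1At d Lc (toSite r) cΛ l))
            (W2SymOfK (unitK (sfStep Lc l) (smStep d Lc l) (coDressKBmAt (toSite r) Lc (KInvStep (d := d) Lc l))) Lc
              (unitS (sfStep Lc l) (smStep d Lc l) (SpureRecAt d Lc (toSite r) cE cVH cΛ l)) (unitM (sfStep Lc l) (smStep d Lc l) (M1At d Lc (toSite r) cΛ l)) 0
              (unitM₂ (sfStep Lc l) (smStep d Lc l) (M2Of d Lc (mixFFAt (toSite r) Lc) l))) κ u κ' u') + cB • vh₂S κ u κ' u')) Cbd δ)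
    (hEd₁ : LocStencil₂ (fun (_ : Fin (d + 1)) (p : Fin (d + 1) → ℤ) (κ' : Fin (d + 1)) (u' : Fin (d + 1) → ℤ) =>
          (cE₂ * (Lc : ℝ) ^ (2 * (d + 1)) * ((Lc : ℝ) ^ (d + 1))⁻¹ / 2) •
            (e3OfK Lc (unitK (sfStep Lc (l + 1)) (smStep d Lc (l + 1)) (coDressKBmAt (toSite r) Lc (KInvStep (d := d) Lc (l + 1))))
              (fun κ' u' => (sfStep Lc (l + 1) * smStep d Lc (l + 1))⁻¹ • unitS (sfStep Lc (l + 1)) (smStep d Lc (l + 1))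
                (fun κ' u' => cH₁⁻¹ • ((((1 : ℝ) + ε) / 2) • (comp (S₁ κ' u') (X p) - comp (X p) (S₁ κ' u')) + (((1 : ℝ) - ε) / 2) • R₁ p κ' u')) κ' u') κ' u'
            + e3OfK Lc (unitK (sfStep Lc (l + 1)) (smStep d Lc (l + 1)) (coDressKBmAt (toSite r) Lc (KInvStep (d := d) Lc (l + 1))))
              (fun κ u => (sfStep Lc (l + 1) * smStep d Lc (l + 1))⁻¹ • unitS (sfStep Lc (l + 1)) (smStep d Lc (l + 1))
                (fun κ u => cH₁⁻¹ • ((((1 : ℝ) + ε) / 2) • (comp (S₁ κ u) (X p) - comp (X p) (S₁ κ u)) + (((1 : ℝ) - ε) / 2) • R₁'' p κ u)) κ u) κ' u')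
        - (cE₂ * (Lc : ℝ) ^ (2 * (d + 1)) * ((Lc : ℝ) ^ (d + 1))⁻¹ / 2) •
            (e3OfK Lc (unitK (sfStep Lc l) (smStep d Lc l) (coDressKBmAt (toSite r) Lc (KInvStep (d := d) Lc l)))
              (fun κ' u' => (sfStep Lc l * smStep d Lc l)⁻¹ • unitS (sfStep Lc l) (smStep d Lc l)
                (fun κ' u' => cH₀⁻¹ • ((((1 : ℝ) + ε) / 2) • (comp (S₀ κ' u') (X p) - comp (X p) (S₀ κ' u')) + (((1 : ℝ) - ε) / 2) • R₀ p κ' u')) κ' u') κ' u'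
            + e3OfK Lc (unitK (sfStep Lc l) (smStep d Lc l) (coDressKBmAt (toSite r) Lc (KInvStep (d := d) Lc l)))
              (fun κ u => (sfStep Lc l * smStep d Lc l)⁻¹ • unitS (sfStep Lc l) (smStep d Lc l)
                (fun κ u => cH₀⁻¹ • ((((1 : ℝ) + ε) / 2) • (comp (S₀ κ u) (X p) - comp (X p) (S₀ κ u)) + (((1 : ℝ) - ε) / 2) • R₀'' p κ u)) κ u) κ' u')) CEd₁ δ) :
    LocStencil₂ (fun (_ : Fin (d + 1)) (p : Fin (d + 1) → ℤ) (κ' : Fin (d + 1)) (u' : Fin (d + 1) → ℤ) =>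
        divV (fun κ₁ u₁ => (((1 / 2 : ℝ) • (unitS₂ (sfStep Lc (l + 1 + 1)) (smStep d Lc (l + 1 + 1)) (T2RecAt d Lc (toSite r) cE cVH cΛ cE₂ cB Tc vh₂S (mixFFAt (toSite r) Lc) (l + 1 + 1))
          + ε • fun κ u κ' u' => sgnK (trK (unitS₂ (sfStep Lc (l + 1 + 1)) (smStep d Lc (l + 1 + 1)) (T2RecAt d Lc (toSite r) cE cVH cΛ cE₂ cB Tc vh₂S (mixFFAt (toSite r) Lc) (l + 1 + 1)) κ u κ' u'))))
        - ((1 / 2 : ℝ) • (unitS₂ (sfStep Lc (l + 1)) (smStep d Lc (l + 1)) (T2RecAt d Lc (toSite r) cE cVH cΛ cE₂ cB Tc vh₂S (mixFFAt (toSite r) Lc) (l + 1))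
          + ε • fun κ u κ' u' => sgnK (trK (unitS₂ (sfStep Lc (l + 1)) (smStep d Lc (l + 1)) (T2RecAt d Lc (toSite r) cE cVH cΛ cE₂ cB Tc vh₂S (mixFFAt (toSite r) Lc) (l + 1)) κ u κ' u'))))) κ₁ u₁ κ' u') p)
      (((d : ℝ) + 1) * (Real.exp (3 * δ) + 1) * Cbd + CEd₁) δ := by
  -- the halved sources' one-step difference keeps (F4b)'s constant
  have hbd : LocStencil₂ (((1 / 2 : ℝ) • ((fun κ u κ' u' => (cE₂ * (Lc : ℝ) ^ (2 * (d + 1))) • mmRead Lc (K3OfK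
            (unitK (sfStep Lc (l + 1)) (smStep d Lc (l + 1)) (coDressKBmAt (toSite r) Lc (KInvStep (d := d) Lc (l + 1)))) Lc
            (unitS (sfStep Lc (l + 1)) (smStep d Lc (l + 1)) (SpureRecAt d Lc (toSite r) cE cVH cΛ (l + 1))) (unitM (sfStep Lc (l + 1)) (smStep d Lc (l + 1)) (M1At d Lc (toSite r) cΛ (l + 1)))
            (W2SymOfK (unitK (sfStep Lc (l + 1)) (smStep d Lc (l + 1)) (coDressKBmAt (toSite r) Lc (KInvStep (d := d) Lc (l + 1)))) Lc
              (unitS (sfStep Lc (l + 1)) (smStep d Lc (l + 1)) (SpureRecAt d Lc (toSite r) cE cVH cΛ (l + 1))) (unitM (sfStep Lc (l + 1)) (smStep d Lc (l + 1)) (M1At d Lc (toSite r) cΛ (l + 1))) 0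
              (unitM₂ (sfStep Lc (l + 1)) (smStep d Lc (l + 1)) (M2Of d Lc (mixFFAt (toSite r) Lc) (l + 1)))) κ u κ' u') + cB • vh₂S κ u κ' u')
          + ε • fun κ u κ' u' => sgnK (trK ((fun κ u κ' u' => (cE₂ * (Lc : ℝ) ^ (2 * (d + 1))) • mmRead Lc (K3OfK
            (unitK (sfStep Lc (l + 1)) (smStep d Lc (l + 1)) (coDressKBmAt (toSite r) Lc (KInvStep (d := d) Lc (l + 1)))) Lc
            (unitS (sfStep Lc (l + 1)) (smStep d Lc (l + 1)) (SpureRecAt d Lc (toSite r) cE cVH cΛ (l + 1))) (unitM (sfStep Lc (l + 1)) (smStep d Lc (l + 1)) (M1At d Lc (toSite r) cΛ (l + 1)))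
            (W2SymOfK (unitK (sfStep Lc (l + 1)) (smStep d Lc (l + 1)) (coDressKBmAt (toSite r) Lc (KInvStep (d := d) Lc (l + 1)))) Lc
              (unitS (sfStep Lc (l + 1)) (smStep d Lc (l + 1)) (SpureRecAt d Lc (toSite r) cE cVH cΛ (l + 1))) (unitM (sfStep Lc (l + 1)) (smStep d Lc (l + 1)) (M1At d Lc (toSite r) cΛ (l + 1))) 0
              (unitM₂ (sfStep Lc (l + 1)) (smStep d Lc (l + 1)) (M2Of d Lc (mixFFAt (toSite r) Lc) (l + 1)))) κ u κ' u') + cB • vh₂S κ u κ' u') κ u κ' u'))))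
        - ((1 / 2 : ℝ) • ((fun κ u κ' u' => (cE₂ * (Lc : ℝ) ^ (2 * (d + 1))) • mmRead Lc (K3OfK
            (unitK (sfStep Lc l) (smStep d Lc l) (coDressKBmAt (toSite r) Lc (KInvStep (d := d) Lc l))) Lc
            (unitS (sfStep Lc l) (smStep d Lc l) (SpureRecAt d Lc (toSite r) cE cVH cΛ l)) (unitM (sfStep Lc l) (smStep d Lc l) (M1At d Lc (toSite r) cΛ l))
            (W2SymOfK (unitK (sfStep Lc l) (smStep d Lc l) (coDressKBmAt (toSite r) Lc (KInvStep (d := d) Lc l))) Lc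
              (unitS (sfStep Lc l) (smStep d Lc l) (SpureRecAt d Lc (toSite r) cE cVH cΛ l)) (unitM (sfStep Lc l) (smStep d Lc l) (M1At d Lc (toSite r) cΛ l)) 0
              (unitM₂ (sfStep Lc l) (smStep d Lc l) (M2Of d Lc (mixFFAt (toSite r) Lc) l))) κ u κ' u') + cB • vh₂S κ u κ' u')
          + ε • fun κ u κ' u' => sgnK (trK ((fun κ u κ' u' => (cE₂ * (Lc : ℝ) ^ (2 * (d + 1))) • mmRead Lc (K3OfK
            (unitK (sfStep Lc l) (smStep d Lc l) (coDressKBmAt (toSite r) Lc (KInvStep (d := d) Lc l))) Lc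
            (unitS (sfStep Lc l) (smStep d Lc l) (SpureRecAt d Lc (toSite r) cE cVH cΛ l)) (unitM (sfStep Lc l) (smStep d Lc l) (M1At d Lc (toSite r) cΛ l))
            (W2SymOfK (unitK (sfStep Lc l) (smStep d Lc l) (coDressKBmAt (toSite r) Lc (KInvStep (d := d) Lc l))) Lc
              (unitS (sfStep Lc l) (smStep d Lc l) (SpureRecAt d Lc (toSite r) cE cVH cΛ l)) (unitM (sfStep Lc l) (smStep d Lc l) (M1At d Lc (toSite r) cΛ l)) 0
              (unitM₂ (sfStep Lc l) (smStep d Lc l) (M2Of d Lc (mixFFAt (toSite r) Lc) l))) κ u κ' u') + cB • vh₂S κ u κ' u') κ u κ' u'))))) Cbd δ := by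
    rw [half_sub]
    exact locStencil₂_halfTable hbF4d hε
  have hA : LocStencil₂ (fun (_ : Fin (d + 1)) (p : Fin (d + 1) → ℤ) (κ' : Fin (d + 1)) (u' : Fin (d + 1) → ℤ) =>
      divV (fun κ₁ u₁ => (((1 / 2 : ℝ) • ((fun κ u κ' u' => (cE₂ * (Lc : ℝ) ^ (2 * (d + 1))) • mmRead Lc (K3OfK
            (unitK (sfStep Lc (l + 1)) (smStep d Lc (l + 1)) (coDressKBmAt (toSite r) Lc (KInvStep (d := d) Lc (l + 1)))) Lc
            (unitS (sfStep Lc (l + 1)) (smStep d Lc (l + 1)) (SpureRecAt d Lc (toSite r) cE cVH cΛ (l + 1))) (unitM (sfStep Lc (l + 1)) (smStep d Lc (l + 1)) (M1At d Lc (toSite r) cΛ (l + 1)))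
            (W2SymOfK (unitK (sfStep Lc (l + 1)) (smStep d Lc (l + 1)) (coDressKBmAt (toSite r) Lc (KInvStep (d := d) Lc (l + 1)))) Lc
              (unitS (sfStep Lc (l + 1)) (smStep d Lc (l + 1)) (SpureRecAt d Lc (toSite r) cE cVH cΛ (l + 1))) (unitM (sfStep Lc (l + 1)) (smStep d Lc (l + 1)) (M1At d Lc (toSite r) cΛ (l + 1))) 0
              (unitM₂ (sfStep Lc (l + 1)) (smStep d Lc (l + 1)) (M2Of d Lc (mixFFAt (toSite r) Lc) (l + 1)))) κ u κ' u') + cB • vh₂S κ u κ' u')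
          + ε • fun κ u κ' u' => sgnK (trK ((fun κ u κ' u' => (cE₂ * (Lc : ℝ) ^ (2 * (d + 1))) • mmRead Lc (K3OfK
            (unitK (sfStep Lc (l + 1)) (smStep d Lc (l + 1)) (coDressKBmAt (toSite r) Lc (KInvStep (d := d) Lc (l + 1)))) Lc
            (unitS (sfStep Lc (l + 1)) (smStep d Lc (l + 1)) (SpureRecAt d Lc (toSite r) cE cVH cΛ (l + 1))) (unitM (sfStep Lc (l + 1)) (smStep d Lc (l + 1)) (M1At d Lc (toSite r) cΛ (l + 1)))
            (W2SymOfK (unitK (sfStep Lc (l + 1)) (smStep d Lc (l + 1)) (coDressKBmAt (toSite r) Lc (KInvStep (d := d) Lc (l + 1)))) Lc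
              (unitS (sfStep Lc (l + 1)) (smStep d Lc (l + 1)) (SpureRecAt d Lc (toSite r) cE cVH cΛ (l + 1))) (unitM (sfStep Lc (l + 1)) (smStep d Lc (l + 1)) (M1At d Lc (toSite r) cΛ (l + 1))) 0
              (unitM₂ (sfStep Lc (l + 1)) (smStep d Lc (l + 1)) (M2Of d Lc (mixFFAt (toSite r) Lc) (l + 1)))) κ u κ' u') + cB • vh₂S κ u κ' u') κ u κ' u'))))
        - ((1 / 2 : ℝ) • ((fun κ u κ' u' => (cE₂ * (Lc : ℝ) ^ (2 * (d + 1))) • mmRead Lc (K3OfK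
            (unitK (sfStep Lc l) (smStep d Lc l) (coDressKBmAt (toSite r) Lc (KInvStep (d := d) Lc l))) Lc
            (unitS (sfStep Lc l) (smStep d Lc l) (SpureRecAt d Lc (toSite r) cE cVH cΛ l)) (unitM (sfStep Lc l) (smStep d Lc l) (M1At d Lc (toSite r) cΛ l))
            (W2SymOfK (unitK (sfStep Lc l) (smStep d Lc l) (coDressKBmAt (toSite r) Lc (KInvStep (d := d) Lc l))) Lc
              (unitS (sfStep Lc l) (smStep d Lc l) (SpureRecAt d Lc (toSite r) cE cVH cΛ l)) (unitM (sfStep Lc l) (smStep d Lc l) (M1At d Lc (toSite r) cΛ l)) 0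
              (unitM₂ (sfStep Lc l) (smStep d Lc l) (M2Of d Lc (mixFFAt (toSite r) Lc) l))) κ u κ' u') + cB • vh₂S κ u κ' u')
          + ε • fun κ u κ' u' => sgnK (trK ((fun κ u κ' u' => (cE₂ * (Lc : ℝ) ^ (2 * (d + 1))) • mmRead Lc (K3OfK
            (unitK (sfStep Lc l) (smStep d Lc l) (coDressKBmAt (toSite r) Lc (KInvStep (d := d) Lc l))) Lc
            (unitS (sfStep Lc l) (smStep d Lc l) (SpureRecAt d Lc (toSite r) cE cVH cΛ l)) (unitM (sfStep Lc l) (smStep d Lc l) (M1At d Lc (toSite r) cΛ l))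
            (W2SymOfK (unitK (sfStep Lc l) (smStep d Lc l) (coDressKBmAt (toSite r) Lc (KInvStep (d := d) Lc l))) Lc
              (unitS (sfStep Lc l) (smStep d Lc l) (SpureRecAt d Lc (toSite r) cE cVH cΛ l)) (unitM (sfStep Lc l) (smStep d Lc l) (M1At d Lc (toSite r) cΛ l)) 0
              (unitM₂ (sfStep Lc l) (smStep d Lc l) (M2Of d Lc (mixFFAt (toSite r) Lc) l))) κ u κ' u') + cB • vh₂S κ u κ' u') κ u κ' u'))))) κ₁ u₁ κ' u') p) (((d : ℝ) + 1) * (Real.exp (3 * δ) + 1) * Cbd) δ :=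
    fun _ p κ' u' x z a b => letter_fst_of_locStencil₂ hbd hδ p κ' u' x z a b
  have e : (fun (_ : Fin (d + 1)) (p : Fin (d + 1) → ℤ) (κ' : Fin (d + 1)) (u' : Fin (d + 1) → ℤ) =>
        divV (fun κ₁ u₁ => (((1 / 2 : ℝ) • (unitS₂ (sfStep Lc (l + 1 + 1)) (smStep d Lc (l + 1 + 1)) (T2RecAt d Lc (toSite r) cE cVH cΛ cE₂ cB Tc vh₂S (mixFFAt (toSite r) Lc) (l + 1 + 1))
          + ε • fun κ u κ' u' => sgnK (trK (unitS₂ (sfStep Lc (l + 1 + 1)) (smStep d Lc (l + 1 + 1)) (T2RecAt d Lc (toSite r) cE cVH cΛ cE₂ cB Tc vh₂S (mixFFAt (toSite r) Lc) (l + 1 + 1)) κ u κ' u'))))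
        - ((1 / 2 : ℝ) • (unitS₂ (sfStep Lc (l + 1)) (smStep d Lc (l + 1)) (T2RecAt d Lc (toSite r) cE cVH cΛ cE₂ cB Tc vh₂S (mixFFAt (toSite r) Lc) (l + 1))
          + ε • fun κ u κ' u' => sgnK (trK (unitS₂ (sfStep Lc (l + 1)) (smStep d Lc (l + 1)) (T2RecAt d Lc (toSite r) cE cVH cΛ cE₂ cB Tc vh₂S (mixFFAt (toSite r) Lc) (l + 1)) κ u κ' u'))))) κ₁ u₁ κ' u') p)
      = (fun (_ : Fin (d + 1)) (p : Fin (d + 1) → ℤ) (κ' : Fin (d + 1)) (u' : Fin (d + 1) → ℤ) =>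
          divV (fun κ₁ u₁ => (((1 / 2 : ℝ) • ((fun κ u κ' u' => (cE₂ * (Lc : ℝ) ^ (2 * (d + 1))) • mmRead Lc (K3OfK
            (unitK (sfStep Lc (l + 1)) (smStep d Lc (l + 1)) (coDressKBmAt (toSite r) Lc (KInvStep (d := d) Lc (l + 1)))) Lc
            (unitS (sfStep Lc (l + 1)) (smStep d Lc (l + 1)) (SpureRecAt d Lc (toSite r) cE cVH cΛ (l + 1))) (unitM (sfStep Lc (l + 1)) (smStep d Lc (l + 1)) (M1At d Lc (toSite r) cΛ (l + 1)))
            (W2SymOfK (unitK (sfStep Lc (l + 1)) (smStep d Lc (l + 1)) (coDressKBmAt (toSite r) Lc (KInvStep (d := d) Lc (l + 1)))) Lc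
              (unitS (sfStep Lc (l + 1)) (smStep d Lc (l + 1)) (SpureRecAt d Lc (toSite r) cE cVH cΛ (l + 1))) (unitM (sfStep Lc (l + 1)) (smStep d Lc (l + 1)) (M1At d Lc (toSite r) cΛ (l + 1))) 0
              (unitM₂ (sfStep Lc (l + 1)) (smStep d Lc (l + 1)) (M2Of d Lc (mixFFAt (toSite r) Lc) (l + 1)))) κ u κ' u') + cB • vh₂S κ u κ' u')
          + ε • fun κ u κ' u' => sgnK (trK ((fun κ u κ' u' => (cE₂ * (Lc : ℝ) ^ (2 * (d + 1))) • mmRead Lc (K3OfK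
            (unitK (sfStep Lc (l + 1)) (smStep d Lc (l + 1)) (coDressKBmAt (toSite r) Lc (KInvStep (d := d) Lc (l + 1)))) Lc
            (unitS (sfStep Lc (l + 1)) (smStep d Lc (l + 1)) (SpureRecAt d Lc (toSite r) cE cVH cΛ (l + 1))) (unitM (sfStep Lc (l + 1)) (smStep d Lc (l + 1)) (M1At d Lc (toSite r) cΛ (l + 1)))
            (W2SymOfK (unitK (sfStep Lc (l + 1)) (smStep d Lc (l + 1)) (coDressKBmAt (toSite r) Lc (KInvStep (d := d) Lc (l + 1)))) Lc
              (unitS (sfStep Lc (l + 1)) (smStep d Lc (l + 1)) (SpureRecAt d Lc (toSite r) cE cVH cΛ (l + 1))) (unitM (sfStep Lc (l + 1)) (smStep d Lc (l + 1)) (M1At d Lc (toSite r) cΛ (l + 1))) 0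
              (unitM₂ (sfStep Lc (l + 1)) (smStep d Lc (l + 1)) (M2Of d Lc (mixFFAt (toSite r) Lc) (l + 1)))) κ u κ' u') + cB • vh₂S κ u κ' u') κ u κ' u'))))
        - ((1 / 2 : ℝ) • ((fun κ u κ' u' => (cE₂ * (Lc : ℝ) ^ (2 * (d + 1))) • mmRead Lc (K3OfK
            (unitK (sfStep Lc l) (smStep d Lc l) (coDressKBmAt (toSite r) Lc (KInvStep (d := d) Lc l))) Lc
            (unitS (sfStep Lc l) (smStep d Lc l) (SpureRecAt d Lc (toSite r) cE cVH cΛ l)) (unitM (sfStep Lc l) (smStep d Lc l) (M1At d Lc (toSite r) cΛ l))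
            (W2SymOfK (unitK (sfStep Lc l) (smStep d Lc l) (coDressKBmAt (toSite r) Lc (KInvStep (d := d) Lc l))) Lc
              (unitS (sfStep Lc l) (smStep d Lc l) (SpureRecAt d Lc (toSite r) cE cVH cΛ l)) (unitM (sfStep Lc l) (smStep d Lc l) (M1At d Lc (toSite r) cΛ l)) 0
              (unitM₂ (sfStep Lc l) (smStep d Lc l) (M2Of d Lc (mixFFAt (toSite r) Lc) l))) κ u κ' u') + cB • vh₂S κ u κ' u')
          + ε • fun κ u κ' u' => sgnK (trK ((fun κ u κ' u' => (cE₂ * (Lc : ℝ) ^ (2 * (d + 1))) • mmRead Lc (K3OfK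
            (unitK (sfStep Lc l) (smStep d Lc l) (coDressKBmAt (toSite r) Lc (KInvStep (d := d) Lc l))) Lc
            (unitS (sfStep Lc l) (smStep d Lc l) (SpureRecAt d Lc (toSite r) cE cVH cΛ l)) (unitM (sfStep Lc l) (smStep d Lc l) (M1At d Lc (toSite r) cΛ l))
            (W2SymOfK (unitK (sfStep Lc l) (smStep d Lc l) (coDressKBmAt (toSite r) Lc (KInvStep (d := d) Lc l))) Lc
              (unitS (sfStep Lc l) (smStep d Lc l) (SpureRecAt d Lc (toSite r) cE cVH cΛ l)) (unitM (sfStep Lc l) (smStep d Lc l) (M1At d Lc (toSite r) cΛ l)) 0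
              (unitM₂ (sfStep Lc l) (smStep d Lc l) (M2Of d Lc (mixFFAt (toSite r) Lc) l))) κ u κ' u') + cB • vh₂S κ u κ' u') κ u κ' u'))))) κ₁ u₁ κ' u') p)
        + (fun (_ : Fin (d + 1)) (p : Fin (d + 1) → ℤ) (κ' : Fin (d + 1)) (u' : Fin (d + 1) → ℤ) =>
          (cE₂ * (Lc : ℝ) ^ (2 * (d + 1)) * ((Lc : ℝ) ^ (d + 1))⁻¹ / 2) •
            (e3OfK Lc (unitK (sfStep Lc (l + 1)) (smStep d Lc (l + 1)) (coDressKBmAt (toSite r) Lc (KInvStep (d := d) Lc (l + 1))))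
              (fun κ' u' => (sfStep Lc (l + 1) * smStep d Lc (l + 1))⁻¹ • unitS (sfStep Lc (l + 1)) (smStep d Lc (l + 1))
                (fun κ' u' => cH₁⁻¹ • ((((1 : ℝ) + ε) / 2) • (comp (S₁ κ' u') (X p) - comp (X p) (S₁ κ' u')) + (((1 : ℝ) - ε) / 2) • R₁ p κ' u')) κ' u') κ' u'
            + e3OfK Lc (unitK (sfStep Lc (l + 1)) (smStep d Lc (l + 1)) (coDressKBmAt (toSite r) Lc (KInvStep (d := d) Lc (l + 1))))
              (fun κ u => (sfStep Lc (l + 1) * smStep d Lc (l + 1))⁻¹ • unitS (sfStep Lc (l + 1)) (smStep d Lc (l + 1))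
                (fun κ u => cH₁⁻¹ • ((((1 : ℝ) + ε) / 2) • (comp (S₁ κ u) (X p) - comp (X p) (S₁ κ u)) + (((1 : ℝ) - ε) / 2) • R₁'' p κ u)) κ u) κ' u')
        - (cE₂ * (Lc : ℝ) ^ (2 * (d + 1)) * ((Lc : ℝ) ^ (d + 1))⁻¹ / 2) •
            (e3OfK Lc (unitK (sfStep Lc l) (smStep d Lc l) (coDressKBmAt (toSite r) Lc (KInvStep (d := d) Lc l)))
              (fun κ' u' => (sfStep Lc l * smStep d Lc l)⁻¹ • unitS (sfStep Lc l) (smStep d Lc l)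
                (fun κ' u' => cH₀⁻¹ • ((((1 : ℝ) + ε) / 2) • (comp (S₀ κ' u') (X p) - comp (X p) (S₀ κ' u')) + (((1 : ℝ) - ε) / 2) • R₀ p κ' u')) κ' u') κ' u'
            + e3OfK Lc (unitK (sfStep Lc l) (smStep d Lc l) (coDressKBmAt (toSite r) Lc (KInvStep (d := d) Lc l)))
              (fun κ u => (sfStep Lc l * smStep d Lc l)⁻¹ • unitS (sfStep Lc l) (smStep d Lc l)
                (fun κ u => cH₀⁻¹ • ((((1 : ℝ) + ε) / 2) • (comp (S₀ κ u) (X p) - comp (X p) (S₀ κ u)) + (((1 : ℝ) - ε) / 2) • R₀'' p κ u)) κ u) κ' u')) := by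
    funext i p κ' u'
    have h₁ : divV (fun κ₁ u₁ => ((1 / 2 : ℝ) • (unitS₂ (sfStep Lc (l + 1 + 1)) (smStep d Lc (l + 1 + 1)) (T2RecAt d Lc (toSite r) cE cVH cΛ cE₂ cB Tc vh₂S (mixFFAt (toSite r) Lc) (l + 1 + 1))
          + ε • fun κ u κ' u' => sgnK (trK (unitS₂ (sfStep Lc (l + 1 + 1)) (smStep d Lc (l + 1 + 1)) (T2RecAt d Lc (toSite r) cE cVH cΛ cE₂ cB Tc vh₂S (mixFFAt (toSite r) Lc) (l + 1 + 1)) κ u κ' u')))) κ₁ u₁ κ' u') p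
        = divV (fun κ₁ u₁ => ((1 / 2 : ℝ) • ((fun κ u κ' u' => (cE₂ * (Lc : ℝ) ^ (2 * (d + 1))) • mmRead Lc (K3OfK
            (unitK (sfStep Lc (l + 1)) (smStep d Lc (l + 1)) (coDressKBmAt (toSite r) Lc (KInvStep (d := d) Lc (l + 1)))) Lc
            (unitS (sfStep Lc (l + 1)) (smStep d Lc (l + 1)) (SpureRecAt d Lc (toSite r) cE cVH cΛ (l + 1))) (unitM (sfStep Lc (l + 1)) (smStep d Lc (l + 1)) (M1At d Lc (toSite r) cΛ (l + 1)))
            (W2SymOfK (unitK (sfStep Lc (l + 1)) (smStep d Lc (l + 1)) (coDressKBmAt (toSite r) Lc (KInvStep (d := d) Lc (l + 1)))) Lc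
              (unitS (sfStep Lc (l + 1)) (smStep d Lc (l + 1)) (SpureRecAt d Lc (toSite r) cE cVH cΛ (l + 1))) (unitM (sfStep Lc (l + 1)) (smStep d Lc (l + 1)) (M1At d Lc (toSite r) cΛ (l + 1))) 0
              (unitM₂ (sfStep Lc (l + 1)) (smStep d Lc (l + 1)) (M2Of d Lc (mixFFAt (toSite r) Lc) (l + 1)))) κ u κ' u') + cB • vh₂S κ u κ' u')
          + ε • fun κ u κ' u' => sgnK (trK ((fun κ u κ' u' => (cE₂ * (Lc : ℝ) ^ (2 * (d + 1))) • mmRead Lc (K3OfK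
            (unitK (sfStep Lc (l + 1)) (smStep d Lc (l + 1)) (coDressKBmAt (toSite r) Lc (KInvStep (d := d) Lc (l + 1)))) Lc
            (unitS (sfStep Lc (l + 1)) (smStep d Lc (l + 1)) (SpureRecAt d Lc (toSite r) cE cVH cΛ (l + 1))) (unitM (sfStep Lc (l + 1)) (smStep d Lc (l + 1)) (M1At d Lc (toSite r) cΛ (l + 1)))
            (W2SymOfK (unitK (sfStep Lc (l + 1)) (smStep d Lc (l + 1)) (coDressKBmAt (toSite r) Lc (KInvStep (d := d) Lc (l + 1)))) Lc
              (unitS (sfStep Lc (l + 1)) (smStep d Lc (l + 1)) (SpureRecAt d Lc (toSite r) cE cVH cΛ (l + 1))) (unitM (sfStep Lc (l + 1)) (smStep d Lc (l + 1)) (M1At d Lc (toSite r) cΛ (l + 1))) 0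
              (unitM₂ (sfStep Lc (l + 1)) (smStep d Lc (l + 1)) (M2Of d Lc (mixFFAt (toSite r) Lc) (l + 1)))) κ u κ' u') + cB • vh₂S κ u κ' u') κ u κ' u')))) κ₁ u₁ κ' u') p
          + (cE₂ * (Lc : ℝ) ^ (2 * (d + 1)) * ((Lc : ℝ) ^ (d + 1))⁻¹ / 2) •
            (e3OfK Lc (unitK (sfStep Lc (l + 1)) (smStep d Lc (l + 1)) (coDressKBmAt (toSite r) Lc (KInvStep (d := d) Lc (l + 1))))
              (fun κ' u' => (sfStep Lc (l + 1) * smStep d Lc (l + 1))⁻¹ • unitS (sfStep Lc (l + 1)) (smStep d Lc (l + 1))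
                (fun κ' u' => cH₁⁻¹ • ((((1 : ℝ) + ε) / 2) • (comp (S₁ κ' u') (X p) - comp (X p) (S₁ κ' u')) + (((1 : ℝ) - ε) / 2) • R₁ p κ' u')) κ' u') κ' u'
            + e3OfK Lc (unitK (sfStep Lc (l + 1)) (smStep d Lc (l + 1)) (coDressKBmAt (toSite r) Lc (KInvStep (d := d) Lc (l + 1))))
              (fun κ u => (sfStep Lc (l + 1) * smStep d Lc (l + 1))⁻¹ • unitS (sfStep Lc (l + 1)) (smStep d Lc (l + 1))
                (fun κ u => cH₁⁻¹ • ((((1 : ℝ) + ε) / 2) • (comp (S₁ κ u) (X p) - comp (X p) (S₁ κ u)) + (((1 : ℝ) - ε) / 2) • R₁'' p κ u)) κ u) κ' u') :=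
      divW_halfMember_succ_eq_slaved hLc hr cE cVH cΛ cE₂ cB Tc hBff hBmm hB (l + 1) hcH₁ hTL₁ hTL₁'' hC₁ hR₁ hR₁'' ε p κ' u'
    have h₀ : divV (fun κ₁ u₁ => ((1 / 2 : ℝ) • (unitS₂ (sfStep Lc (l + 1)) (smStep d Lc (l + 1)) (T2RecAt d Lc (toSite r) cE cVH cΛ cE₂ cB Tc vh₂S (mixFFAt (toSite r) Lc) (l + 1))
          + ε • fun κ u κ' u' => sgnK (trK (unitS₂ (sfStep Lc (l + 1)) (smStep d Lc (l + 1)) (T2RecAt d Lc (toSite r) cE cVH cΛ cE₂ cB Tc vh₂S (mixFFAt (toSite r) Lc) (l + 1)) κ u κ' u')))) κ₁ u₁ κ' u') p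
        = divV (fun κ₁ u₁ => ((1 / 2 : ℝ) • ((fun κ u κ' u' => (cE₂ * (Lc : ℝ) ^ (2 * (d + 1))) • mmRead Lc (K3OfK
            (unitK (sfStep Lc l) (smStep d Lc l) (coDressKBmAt (toSite r) Lc (KInvStep (d := d) Lc l))) Lc
            (unitS (sfStep Lc l) (smStep d Lc l) (SpureRecAt d Lc (toSite r) cE cVH cΛ l)) (unitM (sfStep Lc l) (smStep d Lc l) (M1At d Lc (toSite r) cΛ l))
            (W2SymOfK (unitK (sfStep Lc l) (smStep d Lc l) (coDressKBmAt (toSite r) Lc (KInvStep (d := d) Lc l))) Lc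
              (unitS (sfStep Lc l) (smStep d Lc l) (SpureRecAt d Lc (toSite r) cE cVH cΛ l)) (unitM (sfStep Lc l) (smStep d Lc l) (M1At d Lc (toSite r) cΛ l)) 0
              (unitM₂ (sfStep Lc l) (smStep d Lc l) (M2Of d Lc (mixFFAt (toSite r) Lc) l))) κ u κ' u') + cB • vh₂S κ u κ' u')
          + ε • fun κ u κ' u' => sgnK (trK ((fun κ u κ' u' => (cE₂ * (Lc : ℝ) ^ (2 * (d + 1))) • mmRead Lc (K3OfK
            (unitK (sfStep Lc l) (smStep d Lc l) (coDressKBmAt (toSite r) Lc (KInvStep (d := d) Lc l))) Lc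
            (unitS (sfStep Lc l) (smStep d Lc l) (SpureRecAt d Lc (toSite r) cE cVH cΛ l)) (unitM (sfStep Lc l) (smStep d Lc l) (M1At d Lc (toSite r) cΛ l))
            (W2SymOfK (unitK (sfStep Lc l) (smStep d Lc l) (coDressKBmAt (toSite r) Lc (KInvStep (d := d) Lc l))) Lc
              (unitS (sfStep Lc l) (smStep d Lc l) (SpureRecAt d Lc (toSite r) cE cVH cΛ l)) (unitM (sfStep Lc l) (smStep d Lc l) (M1At d Lc (toSite r) cΛ l)) 0
              (unitM₂ (sfStep Lc l) (smStep d Lc l) (M2Of d Lc (mixFFAt (toSite r) Lc) l))) κ u κ' u') + cB • vh₂S κ u κ' u') κ u κ' u')))) κ₁ u₁ κ' u') p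
          + (cE₂ * (Lc : ℝ) ^ (2 * (d + 1)) * ((Lc : ℝ) ^ (d + 1))⁻¹ / 2) •
            (e3OfK Lc (unitK (sfStep Lc l) (smStep d Lc l) (coDressKBmAt (toSite r) Lc (KInvStep (d := d) Lc l)))
              (fun κ' u' => (sfStep Lc l * smStep d Lc l)⁻¹ • unitS (sfStep Lc l) (smStep d Lc l)
                (fun κ' u' => cH₀⁻¹ • ((((1 : ℝ) + ε) / 2) • (comp (S₀ κ' u') (X p) - comp (X p) (S₀ κ' u')) + (((1 : ℝ) - ε) / 2) • R₀ p κ' u')) κ' u') κ' u'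
            + e3OfK Lc (unitK (sfStep Lc l) (smStep d Lc l) (coDressKBmAt (toSite r) Lc (KInvStep (d := d) Lc l)))
              (fun κ u => (sfStep Lc l * smStep d Lc l)⁻¹ • unitS (sfStep Lc l) (smStep d Lc l)
                (fun κ u => cH₀⁻¹ • ((((1 : ℝ) + ε) / 2) • (comp (S₀ κ u) (X p) - comp (X p) (S₀ κ u)) + (((1 : ℝ) - ε) / 2) • R₀'' p κ u)) κ u) κ' u') :=
      divW_halfMember_succ_eq_slaved hLc hr cE cVH cΛ cE₂ cB Tc hBff hBmm hB l hcH₀ hTL₀ hTL₀'' hC₀ hR₀ hR₀'' ε p κ' u'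
    simp only [Pi.add_apply]
    rw [divV_fst_sub, divV_fst_sub, h₁, h₀]
    abel
  rw [e]
  exact locStencil₂_add hA hEd₁

end Summit.QuantumFields.BalabanUV.Beta.GAN24.HalfMemberSlavedDivergenceDrift

end
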